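import Literature.AlgebraicGeometry.Motives.ThickeningLevelsComplex
import Literature.AlgebraicGeometry.Motives.ConstantFamilyFibre
import HarnessLib

/-!
# Level zero of the Artinian tower at a closed point of a `ℂ`-scheme is `Spec ℂ`

For a `ℂ`-scheme `T′` locally of finite type and a closed point `t`, with `R₀ = 𝒪_{T,t}/𝔪` (`Rt T′ t 0`,
`Motives/ThickeningLevelsComplex`) and its augmentation `ρ₀ = ρℂ T′ t ht 0`: `ρ₀` is bijective (`ρℂ_zero_bijective`, `κ(t) = ℂ`),
every `ℂ`-algebra map `R₀ → ℂ` is `ρ₀` (`algHom_levelZero_eq`), and `thickeningPt T′ t 0 ≅ specOver ℂ ℂ` over `ℂ`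
(`levelZeroIso`, forward map the structure map `toSpecOver`, inverse `Spec ρ₀`).  The base case of the M13 lift induction
([MumfordAV1970] §13: the graph point over the reduced point; [GortzWedhorn2023] Lemma 24.72, Step (I)).  Theorems + the two
morphisms `levelZeroInv`, `levelZeroIso`; no named fact.
HC_CM is proved only modulo the 7 printed citations until rung 0 closes.

## References
* [GortzWedhorn2023] U. Görtz, T. Wedhorn, *Algebraic Geometry II* (2023), Lemma 24.72 (proof, Step (I), p. 410).
* [Hartshorne1977] R. Hartshorne, *Algebraic Geometry* (1977), II.3 (p. 89).
* [MumfordAV1970] D. Mumford, *Abelian Varieties* (1970), §13 (proof of the Thm. pp. 125–130).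
-/

noncomputable section

universe u v

open TensorProduct CategoryTheory AlgebraicGeometry

namespace Literature.AlgebraicGeometry.Motives.AbelianVariety

open CategoryTheory CategoryTheory.Limits AlgebraicGeometry MonoidalCategory CartesianMonoidalCategory
open Literature.AlgebraicGeometry.Morphisms IsLocalRing

variable (T' : SchemeOver ℂ) (t : T'.left) [LocallyOfFiniteType T'.hom] (ht : IsClosed ({t} : Set T'.left))

/-- **(E0-a) `ρ₀ : 𝒪_{T,t}/𝔪 → ℂ` is bijective** (`𝔪^1 = 𝔪` and `κ(t) = ℂ` at a closed point).
[cite: GortzWedhorn2023, Lemma 24.72 (proof, Step (I), p. 410)] -/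
theorem ρℂ_zero_bijective : Function.Bijective (ρℂ T' t ht 0) := by
  constructor
  · intro a b h
    obtain ⟨a, rfl⟩ := Ideal.Quotient.mk_surjective a
    obtain ⟨b, rfl⟩ := Ideal.Quotient.mk_surjective b
    have h2 : ρℂ T' t ht 0 (Ideal.Quotient.mk _ (a - b)) = 0 := by rw [map_sub, map_sub, h, sub_self]
    rw [ρℂ_apply] at h2
    have h' : thickρ T' (topPt T' t) 0 (Ideal.Quotient.mk _ (a - b)) = 0 :=
      κhom_injective T' t ht (by rw [h2, map_zero])
    have hab : a - b ∈ maximalIdeal (stalkAt T' (topPt T' t)) := (thickρ_eq_zero_iff T' (topPt T' t) 0 _).1 h'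
    rw [Ideal.Quotient.eq, zero_add, pow_one]
    exact hab
  · intro c
    exact ⟨algebraMap ℂ _ c, (ρℂ T' t ht 0).commutes c⟩

/-- `algebraMap ∘ ρ₀ = id`: every element of `𝒪_{T,t}/𝔪` is a scalar. [cite: GortzWedhorn2023, Lemma 24.72 (proof, Step (I), p. 410)] -/
theorem algebraMap_ρℂ_zero (r : Rt T' t 0) : algebraMap ℂ (Rt T' t 0) (ρℂ T' t ht 0 r) = r :=
  (ρℂ_zero_bijective T' t ht).1 (by rw [AlgHom.commutes, Algebra.algebraMap_self, RingHom.id_apply])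

/-- **(E0-b) every `ℂ`-algebra map `𝒪_{T,t}/𝔪 → ℂ` is `ρ₀`.** [cite: GortzWedhorn2023, Lemma 24.72 (proof, Step (I), p. 410)] -/
theorem algHom_levelZero_eq (ψ : Rt T' t 0 →ₐ[ℂ] ℂ) : ψ = ρℂ T' t ht 0 := by
  refine AlgHom.ext fun r => ?_
  conv_lhs => rw [← algebraMap_ρℂ_zero T' t ht r]
  rw [AlgHom.commutes, Algebra.algebraMap_self, RingHom.id_apply]

/-- The `ℂ`-point `Spec ℂ → Spec(𝒪_{T,t}/𝔪)` defined by `ρ₀`, as a morphism over `ℂ`. [folklore] -/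
def levelZeroInv : specOver ℂ ℂ ⟶ thickeningPt T' t 0 :=
  Over.homMk (Spec.map (CommRingCat.ofHom (ρℂ T' t ht 0).toRingHom)) (by
    rw [thickeningPt_hom_eq]
    change Spec.map _ ≫ Spec.map _ = Spec.map (CommRingCat.ofHom (algebraMap ℂ ℂ))
    rw [← Spec.map_comp]
    congr 1
    apply CommRingCat.hom_ext
    refine RingHom.ext fun c => ?_
    change ρℂ T' t ht 0 (algebraMap ℂ (Rt T' t 0) c) = algebraMap ℂ ℂ c
    rw [AlgHom.commutes])

/-- **(E0-c) level zero is `Spec ℂ`**: `thickeningPt T′ t 0 ≅ specOver ℂ ℂ` over `ℂ`, forward map the structure map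
`toSpecOver`, inverse `Spec ρ₀`. [cite: Hartshorne1977, II.3 (p. 89)] -/
def levelZeroIso : thickeningPt T' t 0 ≅ specOver ℂ ℂ where
  hom := toSpecOver (thickeningPt T' t 0)
  inv := levelZeroInv T' t ht
  hom_inv_id := by
    apply Over.OverMorphism.ext
    rw [Over.comp_left, toSpecOver_left, Over.id_left, thickeningPt_hom_eq]
    change Spec.map _ ≫ Spec.map (CommRingCat.ofHom (ρℂ T' t ht 0).toRingHom) = 𝟙 _
    rw [← Spec.map_comp]
    have h1 : CommRingCat.ofHom (ρℂ T' t ht 0).toRingHom ≫ CommRingCat.ofHom (algebraMap ℂ (Rt T' t 0)) = 𝟙 _ := by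
      apply CommRingCat.hom_ext
      refine RingHom.ext fun r => ?_
      exact algebraMap_ρℂ_zero T' t ht r
    rw [h1, Spec.map_id]
  inv_hom_id := Subsingleton.elim _ _

/-- `levelZeroIso.hom` is the structure map. [cite: GortzWedhorn2023, Lemma 24.72 (proof, Step (I), p. 410)] -/
theorem levelZeroIso_hom : (levelZeroIso T' t ht).hom = toSpecOver (thickeningPt T' t 0) := rfl

/-- `levelZeroIso.inv` is `Spec ρ₀` on underlying schemes. [cite: GortzWedhorn2023, Lemma 24.72 (proof, Step (I), p. 410)] -/
theorem levelZeroIso_inv_left :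
    (levelZeroIso T' t ht).inv.left = Spec.map (CommRingCat.ofHom (ρℂ T' t ht 0).toRingHom) := rfl

end Literature.AlgebraicGeometry.Motives.AbelianVariety

end
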